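import Summits.Schanuel.Schanuel.Theses.RoyCriterion
import Literature.NumberTheory.Transcendental.RoySmallValueMain
import Literature.NumberTheory.Transcendental.LindemannWeierstrassProofs
import Summits.Schanuel.Schanuel.Theorems.RoyCriterionRoySmallValueDirichletGapDefs

/-!
# Route `RoyCriterion`, crux `RoySmallValueDirichletGap` (stmt-Schanuel-1050), line
# `two-sided-absorption-transfer` — free structure of links (support for the open stub
# `stub_tangentialTowerEmptiness`)

What every attack on the line's open residual `TangentialTowerEmptiness` (Defs file
`RoyCriterionRoySmallValueDirichletGapDefs.lean`) starts from, proved from the link clauses alone: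

* `IsLink.exists_hugger` — every link has a NEAR point `p ∈ P ∩ 𝒰` with
  `leafCloseness_T(p) ≤ −(D^δ/C)·D^β` (Roy 2013, §7, Step 2: "`𝒰` is not empty and contains a point
  `α₀` with `log dist(α₀,(1:γ)) ≤ −D^{δ+β}/(25T)`"), and `IsLink.coords_le_of_leafCloseness_le`
  reads such a bound coordinate-wise (point-closeness at depth `T`, leaf-closeness);
* `IsLink.exists_pdist_le` — hence a point within `exp(−D^{δ+β−τ}/C)` of `(1:γ)`; in particular a
  FIXED finite set serves as a link at boundedly many levels only (mortality of enemies);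
* `adist_smul`, `leaf_unique` — the leaf distance is projective, and two algebraic points at leaf
  distance `0` coincide in `ℙ²` (at most ONE algebraic point on the leaf `A_γ = {(1 : ξ+z : ηe^z)}`,
  `η ≠ 0`), by Hermite–Lindemann (`transcendental_exp_holds`, tree).

References: D. Roy, *A small value estimate for 𝔾ₐ × 𝔾ₘ*, Mathematika 59 (2013) = arXiv:1301.0663,
§7 Step 2; Hermite–Lindemann (Lindemann 1882; Baker, *Transcendental Number Theory*, Thm 1.4).
-/

-- `Summit.Schanuel.Schanuel.…` is the mandated layout of this single-problem summit (CONVENTIONS §1).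
set_option linter.dupNamespace false

noncomputable section

namespace Summit.Schanuel.Schanuel.Theorems.RoyLinks

open Filter MvPolynomial Finset Height
open Literature.NumberTheory.Transcendental
open Literature.NumberTheory.Transcendental.Roy2013
open Summit.Schanuel.Schanuel.Theses.RoyCriterion (RoySmallValueDirichletGap)

/-! ## Free structure of links (support lemmas for the open stub `stub_tangentialTowerEmptiness`) -/

namespace IsLink

variable {C : ℝ} {ξ η : ℂ} {β τ δ : ℝ} {D : ℕ} {P : Finset (Fin 3 → ℂ)} {h : ℝ} {Ds : ℕ}

/-- **Every link has a hugger** (Roy 2013, §7, Step 2, "the set `𝒰` is not empty and contains a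
point `α₀` with `log dist(α₀,(1:γ)) ≤ −D^{δ+β}/(25T)`", in the link currency): some near point
`p ∈ P ∩ 𝒰` has `leafCloseness_T(p) ≤ −(D^δ/C)·D^β`. [cite: Roy2013, §7, Step 2] -/
theorem exists_hugger (hL : IsLink C ξ η β τ δ D P h Ds) :
    ∃ p ∈ P, IsNear ξ η p ∧
      leafCloseness ξ η ⌊(D : ℝ) ^ τ⌋₊ p ≤ -((D : ℝ) ^ δ / C * (D : ℝ) ^ β) := by
  have hC : 0 < C := hL.const_pos
  obtain ⟨-, -, -, hne, hDs1, hDsD, -, hh0, -, -, hmass, -⟩ := hL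
  have hd1 : (1 : ℝ) ≤ P.card := by exact_mod_cast hne.card_pos
  have hD1 : (1 : ℝ) ≤ D := by
    have : (1 : ℝ) ≤ Ds := by exact_mod_cast hDs1
    have : (Ds : ℝ) ≤ D := by exact_mod_cast hDsD.le
    linarith
  have hD0 : (0 : ℝ) < D := by linarith
  have hM : 0 < (D : ℝ) ^ δ / C * (D : ℝ) ^ β :=
    mul_pos (div_pos (Real.rpow_pos_of_pos hD0 _) hC) (Real.rpow_pos_of_pos hD0 _)
  have hcard : (((P.filter (IsNear ξ η)).card : ℕ) : ℝ) ≤ P.card := by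
    exact_mod_cast card_filter_le _ _
  have hsum : ∑ p ∈ P.filter (IsNear ξ η), leafCloseness ξ η ⌊(D : ℝ) ^ τ⌋₊ p ≤
      -((D : ℝ) ^ δ / C * (D : ℝ) ^ β * P.card) := by
    refine hmass.trans ?_
    have e : (D : ℝ) ^ δ / C * ((D : ℝ) ^ β * P.card + D * h) =
        (D : ℝ) ^ δ / C * (D : ℝ) ^ β * P.card + (D : ℝ) ^ δ / C * (D * h) := by ring
    have hpos : 0 ≤ (D : ℝ) ^ δ / C * (D * h) :=
      mul_nonneg (div_nonneg (Real.rpow_nonneg hD0.le _) hC.le) (mul_nonneg hD0.le hh0)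
    rw [e]; linarith
  obtain ⟨p, hp, hle⟩ := exists_le_of_sum_le_neg (P.filter (IsNear ξ η))
    (fun p => leafCloseness ξ η ⌊(D : ℝ) ^ τ⌋₊ p) hM (by linarith) hcard hsum
  exact ⟨p, (mem_filter.mp hp).1, (mem_filter.mp hp).2, hle⟩

/-- Reading a bound `leafCloseness_T(p) ≤ −M` coordinate-wise: `T·log dist(p̄,(1:γ)) ≤ −M`, and
`log dist(p̄, A_γ) ≤ −M` whenever that distance is positive. [cite: Roy2013, §7, Step 2] -/
theorem coords_le_of_leafCloseness_le {T : ℕ} {p : Fin 3 → ℂ} {M : ℝ}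
    (hp : leafCloseness ξ η T p ≤ -M) :
    (T : ℝ) * Real.log (pdist ξ η (supNormalise p)) ≤ -M ∧
      (0 < adist ξ η (supNormalise p) → Real.log (adist ξ η (supNormalise p)) ≤ -M) := by
  refine ⟨(le_max_left _ _).trans hp, fun hpos => ?_⟩
  have h2 : (if 0 < adist ξ η (supNormalise p) then Real.log (adist ξ η (supNormalise p))
      else (T : ℝ) * Real.log (pdist ξ η (supNormalise p))) ≤ -M := (le_max_right _ _).trans hp
  rwa [if_pos hpos] at h2

/-- **Every link has a point exponentially close to `(1:γ)`**: some `p ∈ P` has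
`dist(p̄,(1:γ)) ≤ exp(−D^{δ+β−τ}/C)` (`τ ≥ 0`; from the hugger and `T ≤ D^τ`).  Consequently a FIXED
finite set `P` (whose points are all `≠ (1:γ)`) is a link at level `D` only for boundedly many `D`
(mortality of enemies). [cite: Roy2013, §7, Step 2] -/
theorem exists_pdist_le (hL : IsLink C ξ η β τ δ D P h Ds) (hτ : 0 ≤ τ) :
    ∃ p ∈ P, pdist ξ η (supNormalise p) ≤ Real.exp (-((D : ℝ) ^ (δ + β - τ) / C)) := by
  have hC : 0 < C := hL.const_pos
  have hDs1 := hL.2.2.2.2.1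
  have hDsD := hL.2.2.2.2.2.1
  have hpos := hL.2.2.1
  obtain ⟨p, hpP, -, hle⟩ := hL.exists_hugger
  refine ⟨p, hpP, ?_⟩
  have hD1 : (1 : ℝ) ≤ D := by
    have : (1 : ℝ) ≤ Ds := by exact_mod_cast hDs1
    have : (Ds : ℝ) ≤ D := by exact_mod_cast hDsD.le
    linarith
  have hD0 : (0 : ℝ) < D := by linarith
  have hDnat : 1 ≤ D := by exact_mod_cast hD1
  obtain ⟨h1, -⟩ := coords_le_of_leafCloseness_le hle
  -- `T ≥ 1`, `T ≤ D^τ`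
  have hT1 : (1 : ℝ) ≤ (⌊(D : ℝ) ^ τ⌋₊ : ℕ) := by exact_mod_cast one_le_natFloor_rpow hDnat hτ
  have hTle : ((⌊(D : ℝ) ^ τ⌋₊ : ℕ) : ℝ) ≤ (D : ℝ) ^ τ := natFloor_rpow_le D τ
  have hT0 : (0 : ℝ) < (⌊(D : ℝ) ^ τ⌋₊ : ℕ) := by linarith
  have hρ0 : 0 < pdist ξ η (supNormalise p) := hpos p hpP
  -- `log ρ ≤ −(D^δ/C · D^β)/T ≤ −D^{δ+β−τ}/C`
  have hlog : Real.log (pdist ξ η (supNormalise p)) ≤ -((D : ℝ) ^ (δ + β - τ) / C) := by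
    have h2 : Real.log (pdist ξ η (supNormalise p)) ≤ -((D : ℝ) ^ δ / C * (D : ℝ) ^ β) / (⌊(D : ℝ) ^ τ⌋₊ : ℕ) := by
      rw [le_div_iff₀ hT0]; linarith
    refine h2.trans ?_
    have hsplit : (D : ℝ) ^ δ / C * (D : ℝ) ^ β = (D : ℝ) ^ (δ + β - τ) / C * (D : ℝ) ^ τ := by
      rw [show δ + β - τ = δ + (β - τ) by ring, Real.rpow_add hD0, Real.rpow_sub hD0]
      field_simp
    rw [hsplit, neg_div, neg_le_neg_iff, le_div_iff₀ hT0]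
    have hq : 0 ≤ (D : ℝ) ^ (δ + β - τ) / C := div_nonneg (Real.rpow_nonneg hD0.le _) hC.le
    calc (D : ℝ) ^ (δ + β - τ) / C * (⌊(D : ℝ) ^ τ⌋₊ : ℕ) ≤ (D : ℝ) ^ (δ + β - τ) / C * (D : ℝ) ^ τ :=
          mul_le_mul_of_nonneg_left hTle hq
      _ = _ := rfl
  exact (Real.log_le_iff_le_exp hρ0).mp hlog

end IsLink

/-! ## At most one algebraic point on the leaf (Hermite–Lindemann) -/

/-- The leaf distance is invariant under rescaling the representative. [folklore] -/
theorem adist_smul (ξ η : ℂ) {c : ℂ} (hc : c ≠ 0) (α : Fin 3 → ℂ) :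
    adist ξ η (c • α) = adist ξ η α := by
  simp only [adist, Pi.smul_apply, smul_eq_mul]
  by_cases h0 : α 0 = 0
  · simp [h0]
  · rw [mul_div_mul_left _ _ hc, mul_div_mul_left _ _ hc]

/-- **At most one algebraic point on the leaf `A_γ`** (`η ≠ 0`): two points of `ℂ³` with algebraic
coordinates and leaf distance `0` have the same affine coordinates `x₁/x₀`, `x₂/x₀` (leaf distance `0`
forces `x₀ ≠ 0`, as `η e^{·} ≠ 0`).  Proof: on
the leaf `α₂/α₀ = η e^{α₁/α₀ − ξ}`, so the quotient of the two relations is `e^{a − a'} ∈ ℚ̄` with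
`a − a' ∈ ℚ̄`, forcing `a = a'` by Hermite–Lindemann (`transcendental_exp_holds`). This is the
"mortality"/rigidity input every attack on the open stub starts from. [cite: Lindemann1882, via BakerTNT1975 Ch. 1 §3 Theorem 1.4, p. 6] -/
theorem leaf_unique {ξ η : ℂ} (hη : η ≠ 0) {p q : Fin 3 → ℂ}
    (hpa : ∀ k, IsAlgebraic ℚ (p k)) (hqa : ∀ k, IsAlgebraic ℚ (q k))
    (hp : adist ξ η p = 0) (hq : adist ξ η q = 0) :
    p 1 / p 0 = q 1 / q 0 ∧ p 2 / p 0 = q 2 / q 0 := by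
  -- the two leaf relations
  have hp' : p 2 / p 0 = η * Complex.exp (p 1 / p 0 - ξ) := by
    have := norm_eq_zero.mp hp; exact sub_eq_zero.mp this
  have hq' : q 2 / q 0 = η * Complex.exp (q 1 / q 0 - ξ) := by
    have := norm_eq_zero.mp hq; exact sub_eq_zero.mp this
  -- algebraicity of the affine coordinates
  have ha : IsAlgebraic ℚ (p 1 / p 0) := (hpa 1).mul (hpa 0).inv
  have hb : IsAlgebraic ℚ (p 2 / p 0) := (hpa 2).mul (hpa 0).inv
  have ha' : IsAlgebraic ℚ (q 1 / q 0) := (hqa 1).mul (hqa 0).inv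
  have hb' : IsAlgebraic ℚ (q 2 / q 0) := (hqa 2).mul (hqa 0).inv
  have hbq0 : q 2 / q 0 ≠ 0 := by rw [hq']; exact mul_ne_zero hη (Complex.exp_ne_zero _)
  -- the quotient `e^{a − a'}` is algebraic
  have hquot : (p 2 / p 0) / (q 2 / q 0) = Complex.exp (p 1 / p 0 - q 1 / q 0) := by
    rw [hp', hq', mul_div_mul_left _ _ hη, ← Complex.exp_sub]
    congr 1; ring
  have halg : IsAlgebraic ℚ (Complex.exp (p 1 / p 0 - q 1 / q 0)) := by
    rw [← hquot]; exact hb.mul hb'.inv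
  have hdiff : IsAlgebraic ℚ (p 1 / p 0 - q 1 / q 0) := ha.sub ha'
  -- Hermite–Lindemann
  have h0 : p 1 / p 0 - q 1 / q 0 = 0 := by
    by_contra hne
    exact transcendental_exp_holds hdiff hne halg
  have h1 : p 1 / p 0 = q 1 / q 0 := sub_eq_zero.mp h0
  refine ⟨h1, ?_⟩
  rw [hp', hq', h1]

end Summit.Schanuel.Schanuel.Theorems.RoyLinks

end
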